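import Summits.ValiantsHypothesis.ValiantsHypothesis.Theorems.GrenetZeonDualUnipotentThreeHalvesLongMassNilSpaceWordsTriangularisable
import Summits.ValiantsHypothesis.ValiantsHypothesis.Theorems.GrenetZeonDualUnipotentThreeHalvesLongMassSubmodule

/-!
# `GrenetZeon.DualUnipotentThreeHalves` (stmt-ValiantsHypothesis-24318), line `slow_core`, stub (c) `SlowCore.LongMassSlowLawInv`:
# PER-SPACE BRIDGE pencil ⇒ submodule currency, and the TRIANGULARISABLE / ENGEL / WORD rows in the submodule currency

✓ `longMassSlowLawInv_iff_submodule` (`…LongMassSubmodule`) moves (c) as a WHOLE between the pencil currency (`SlowCore.RelCert`) and the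
coordinate-free submodule currency; the rows of the menu (✓ `TriangularRow.relCert_of_valueSpace_triangularisable`, ✓ `NilSpaceEngel.relCert_of_valueSpace_lieClosed`,
✓ `relCert_of_valueSpace_words_eq_zero`) are priced in the pencil currency.  This file packages the `(⇒)` half of that equivalence PER SPACE, so that
every value-space row is available verbatim to seats working with `V ≤ M_b(ℂ)`:

* ★★ `price_submodule_of_relCert_linear` — THE BRIDGE: if every LINEAR pencil over the `n²` coordinates with values in `V` (`dim V ≤ n²`) has
  `RelCert n b · P`, then `V` has a submodule certificate `(W, k)` of price `≤ P` (place a basis of `V` on coordinates — ✓ `exists_linear_of_submodule`;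
  push the direction space forward — ✓ `codim_map_le_codim`; lines of a linear pencil — ✓ `map_lineSubst_eq_add_smul`).
* ★★ `price_triangularisable_submodule` — `P·V·P⁻¹` strictly upper triangular for one unit `P` ⇒ price `≤ 3·(⌊√n⌋·b)`;
  ★ `price_lieClosed_submodule` (ENGEL ROW), `price_mulClosed_submodule`, `price_commute_submodule`, ★ `price_words_eq_zero_submodule` (WORD ROW) —
  the same price on Lie-closed nil spaces / nil algebras / commutative nil spaces / spaces all of whose words of some length vanish.

HONEST FRAMING.  Dictionary / calibration (`--supports stmt-ValiantsHypothesis-24318`); NOT progress on the research stub (c) `SlowCore.LongMassSlowLawInv`;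
closes no stub; S3, 24318, 8062 and `VP ≠ VNP` are NOT proved.  Def-free, no named-fact hypotheses, no sorry.
[cite: HornJohnson2013, Thm. 2.4.8.7 (p0162)]
-/

set_option linter.dupNamespace false
set_option autoImplicit false

noncomputable section

namespace Summit.ValiantsHypothesis.ValiantsHypothesis.Theorems.GrenetZeon.NilSpaceEngel

open MvPolynomial Matrix
open scoped BigOperators
open Summit.ValiantsHypothesis.ValiantsHypothesis.Cruxes.TwoDimCoefficients.DimTwoCases (AffMat IsAffine)
open Summit.ValiantsHypothesis.ValiantsHypothesis.Theorems.GrenetZeon.SlowCore (RelCert)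
open Summit.ValiantsHypothesis.ValiantsHypothesis.Theorems.GrenetZeon.ResolventFlag (linMat)
open Summit.ValiantsHypothesis.ValiantsHypothesis.Theorems.GrenetZeon.LedgerIndex (exists_linearMap_linMat codim_map_le_codim)
open Summit.ValiantsHypothesis.ValiantsHypothesis.Theorems.GrenetZeon.LongMassHomogenise
  (map_lineSubst_eq_add_smul exists_linear_of_submodule map_eval_eq_linMat_of_linear)
open Summit.ValiantsHypothesis.ValiantsHypothesis.Theorems.GrenetZeon.TriangularRow (relCert_of_valueSpace_triangularisable)

variable {n b : ℕ}

/-! ## §1 The per-space bridge -/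

/-- ★★ **PENCIL ⇒ SUBMODULE, PER SPACE.**  Let `V ≤ M_b(ℂ)` with `dim V ≤ n²`.  If every LINEAR affine pencil `N₁` over the `n²` coordinates
whose values all lie in `V` has `RelCert n b N₁ P`, then `V` has a submodule certificate of price `≤ P`: some `W ≤ V`, `k` with the window
property (all entries of `(A + s w)^p`, `A ∈ V`, `w ∈ W`, `p ≤ n − 1`, of `s`-degree `≤ k`) and `n·k + (dim V − dim W) ≤ P`.
(The `(⇒)` half of ✓ `longMassSlowLawAll_linear_iff_submodule`, per space.) -/
theorem price_submodule_of_relCert_linear (V : Submodule ℂ (Matrix (Fin b) (Fin b) ℂ)) (hV : Module.finrank ℂ V ≤ n * n) (P : ℕ)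
    (h : ∀ N₁ : AffMat n b, IsAffine N₁ → (∀ i j, coeff 0 (N₁ i j) = 0) →
      (∀ x : Fin n × Fin n → ℂ, N₁.map (MvPolynomial.eval x) ∈ V) → RelCert n b N₁ P) :
    ∃ (W : Submodule ℂ (Matrix (Fin b) (Fin b) ℂ)) (k : ℕ), W ≤ V ∧
      (∀ A ∈ V, ∀ w ∈ W, ∀ p : ℕ, p ≤ n - 1 → ∀ i j : Fin b,
        ((((A.map (C : ℂ → MvPolynomial (Fin 1) ℂ) + (X 0 : MvPolynomial (Fin 1) ℂ) • w.map C) ^ p :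
          Matrix (Fin b) (Fin b) (MvPolynomial (Fin 1) ℂ)) i j).totalDegree ≤ k)) ∧
      n * k + (Module.finrank ℂ V - Module.finrank ℂ W) ≤ P := by
  obtain ⟨N₁, haff, h0₁, hmemV, hsurj⟩ := exists_linear_of_submodule (n := n) V hV
  obtain ⟨T₁, hT₁⟩ := exists_linearMap_linMat N₁
  have hrange : LinearMap.range T₁ = V := by
    apply le_antisymm
    · rintro _ ⟨y, rfl⟩; rw [hT₁]; exact hmemV y
    · intro A hA
      obtain ⟨y, hy⟩ := hsurj A hA
      exact ⟨y, by rw [hT₁, hy]⟩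
  have hvals : ∀ x : Fin n × Fin n → ℂ, N₁.map (MvPolynomial.eval x) ∈ V := fun x => by
    rw [map_eval_eq_linMat_of_linear N₁ haff h0₁ x]; exact hmemV x
  obtain ⟨K₁, k, hK₁, hprice⟩ := h N₁ haff h0₁ hvals
  refine ⟨K₁.map T₁, k, by rw [← hrange]; exact LinearMap.map_le_range, ?_, ?_⟩
  · intro A hA w hw p hp i j
    obtain ⟨x₁, hx₁⟩ := hsurj A hA
    obtain ⟨v₁, hv₁K, hv₁⟩ := Submodule.mem_map.mp hw
    rw [hT₁] at hv₁
    have := hK₁ x₁ v₁ hv₁K p hp i j trivial trivial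
    rwa [map_lineSubst_eq_add_smul N₁ haff h0₁, hx₁, hv₁] at this
  · have h3 := codim_map_le_codim T₁ K₁
    rw [hrange] at h3
    exact le_trans (Nat.add_le_add_left h3 _) hprice

/-! ## §2 The triangularisable / Engel / word rows in the submodule currency -/

/-- ★★ **TRIANGULARISABLE ROW, submodule currency.**  If one unit `P` makes every `P A P⁻¹`, `A ∈ V`, strictly upper triangular and
`dim V ≤ n²`, then `V` has a certificate of price `≤ 3·(⌊√n⌋·b)`. -/
theorem price_triangularisable_submodule (V : Submodule ℂ (Matrix (Fin b) (Fin b) ℂ)) (hV : Module.finrank ℂ V ≤ n * n)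
    (P : (Matrix (Fin b) (Fin b) ℂ)ˣ)
    (hP : ∀ A ∈ V, ∀ i j : Fin b, j ≤ i → ((P : Matrix (Fin b) (Fin b) ℂ) * A * (↑P⁻¹ : Matrix (Fin b) (Fin b) ℂ)) i j = 0) :
    ∃ (W : Submodule ℂ (Matrix (Fin b) (Fin b) ℂ)) (k : ℕ), W ≤ V ∧
      (∀ A ∈ V, ∀ w ∈ W, ∀ p : ℕ, p ≤ n - 1 → ∀ i j : Fin b,
        ((((A.map (C : ℂ → MvPolynomial (Fin 1) ℂ) + (X 0 : MvPolynomial (Fin 1) ℂ) • w.map C) ^ p :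
          Matrix (Fin b) (Fin b) (MvPolynomial (Fin 1) ℂ)) i j).totalDegree ≤ k)) ∧
      n * k + (Module.finrank ℂ V - Module.finrank ℂ W) ≤ 3 * (Nat.sqrt n * b) :=
  price_submodule_of_relCert_linear V hV _ fun N₁ haff _ hvals =>
    relCert_of_valueSpace_triangularisable N₁ haff V hvals P hP

/-- ★ **ENGEL ROW, submodule currency.**  A Lie-closed space of nilpotent matrices `V ≤ M_b(ℂ)` with `dim V ≤ n²` has a certificate of
price `≤ 3·(⌊√n⌋·b)`. [cite: HornJohnson2013, Thm. 2.4.8.7 (p0162)] -/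
theorem price_lieClosed_submodule (V : Submodule ℂ (Matrix (Fin b) (Fin b) ℂ)) (hV : Module.finrank ℂ V ≤ n * n)
    (hnil : ∀ A ∈ V, IsNilpotent A) (hlie : ∀ A ∈ V, ∀ B ∈ V, A * B - B * A ∈ V) :
    ∃ (W : Submodule ℂ (Matrix (Fin b) (Fin b) ℂ)) (k : ℕ), W ≤ V ∧
      (∀ A ∈ V, ∀ w ∈ W, ∀ p : ℕ, p ≤ n - 1 → ∀ i j : Fin b,
        ((((A.map (C : ℂ → MvPolynomial (Fin 1) ℂ) + (X 0 : MvPolynomial (Fin 1) ℂ) • w.map C) ^ p :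
          Matrix (Fin b) (Fin b) (MvPolynomial (Fin 1) ℂ)) i j).totalDegree ≤ k)) ∧
      n * k + (Module.finrank ℂ V - Module.finrank ℂ W) ≤ 3 * (Nat.sqrt n * b) := by
  obtain ⟨P, hP⟩ := exists_unit_conj_strictUpper_of_lieClosed V hnil hlie
  exact price_triangularisable_submodule V hV P hP

/-- **Nil algebras**, submodule currency. [folklore] -/
theorem price_mulClosed_submodule (V : Submodule ℂ (Matrix (Fin b) (Fin b) ℂ)) (hV : Module.finrank ℂ V ≤ n * n)
    (hnil : ∀ A ∈ V, IsNilpotent A) (hmul : ∀ A ∈ V, ∀ B ∈ V, A * B ∈ V) :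
    ∃ (W : Submodule ℂ (Matrix (Fin b) (Fin b) ℂ)) (k : ℕ), W ≤ V ∧
      (∀ A ∈ V, ∀ w ∈ W, ∀ p : ℕ, p ≤ n - 1 → ∀ i j : Fin b,
        ((((A.map (C : ℂ → MvPolynomial (Fin 1) ℂ) + (X 0 : MvPolynomial (Fin 1) ℂ) • w.map C) ^ p :
          Matrix (Fin b) (Fin b) (MvPolynomial (Fin 1) ℂ)) i j).totalDegree ≤ k)) ∧
      n * k + (Module.finrank ℂ V - Module.finrank ℂ W) ≤ 3 * (Nat.sqrt n * b) := by
  obtain ⟨P, hP⟩ := exists_unit_conj_strictUpper_of_mulClosed V hnil hmul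
  exact price_triangularisable_submodule V hV P hP

/-- **Commutative nil spaces**, submodule currency. [folklore] -/
theorem price_commute_submodule (V : Submodule ℂ (Matrix (Fin b) (Fin b) ℂ)) (hV : Module.finrank ℂ V ≤ n * n)
    (hnil : ∀ A ∈ V, IsNilpotent A) (hcomm : ∀ A ∈ V, ∀ B ∈ V, A * B = B * A) :
    ∃ (W : Submodule ℂ (Matrix (Fin b) (Fin b) ℂ)) (k : ℕ), W ≤ V ∧
      (∀ A ∈ V, ∀ w ∈ W, ∀ p : ℕ, p ≤ n - 1 → ∀ i j : Fin b,
        ((((A.map (C : ℂ → MvPolynomial (Fin 1) ℂ) + (X 0 : MvPolynomial (Fin 1) ℂ) • w.map C) ^ p :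
          Matrix (Fin b) (Fin b) (MvPolynomial (Fin 1) ℂ)) i j).totalDegree ≤ k)) ∧
      n * k + (Module.finrank ℂ V - Module.finrank ℂ W) ≤ 3 * (Nat.sqrt n * b) := by
  obtain ⟨P, hP⟩ := exists_unit_conj_strictUpper_of_commute V hnil hcomm
  exact price_triangularisable_submodule V hV P hP

/-- ★ **WORD ROW, submodule currency.**  If every `V`-word of some length `s` vanishes (`dim V ≤ n²`), `V` has a certificate of price
`≤ 3·(⌊√n⌋·b)`. [folklore] -/
theorem price_words_eq_zero_submodule (V : Submodule ℂ (Matrix (Fin b) (Fin b) ℂ)) (hV : Module.finrank ℂ V ≤ n * n) {s : ℕ}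
    (hwords : ∀ w : Fin s → Matrix (Fin b) (Fin b) ℂ, (∀ t, w t ∈ V) → (List.ofFn w).prod = 0) :
    ∃ (W : Submodule ℂ (Matrix (Fin b) (Fin b) ℂ)) (k : ℕ), W ≤ V ∧
      (∀ A ∈ V, ∀ w ∈ W, ∀ p : ℕ, p ≤ n - 1 → ∀ i j : Fin b,
        ((((A.map (C : ℂ → MvPolynomial (Fin 1) ℂ) + (X 0 : MvPolynomial (Fin 1) ℂ) • w.map C) ^ p :
          Matrix (Fin b) (Fin b) (MvPolynomial (Fin 1) ℂ)) i j).totalDegree ≤ k)) ∧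
      n * k + (Module.finrank ℂ V - Module.finrank ℂ W) ≤ 3 * (Nat.sqrt n * b) := by
  obtain ⟨P, hP⟩ := exists_unit_conj_strictUpper_of_words_eq_zero V hwords
  exact price_triangularisable_submodule V hV P hP

end Summit.ValiantsHypothesis.ValiantsHypothesis.Theorems.GrenetZeon.NilSpaceEngel

end
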